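import Summits.BirchSwinnertonDyer.BirchSwinnertonDyer.Theorems.TwoAdicConverseOrdLambdaHalfAtTwoShapiroLatticeSupply
import Literature.NumberTheory.EllipticCurves.Kato2004.IwasawaCohomologyNumberFieldTwistCross
import Literature.NumberTheory.EllipticCurves.Kato2004.IwasawaCohomology
import Literature.NumberTheory.EllipticCurves.SelmerPInftyRelModelAction
import HarnessLib

/-!
# Route `TwoAdicConverse` (rung S3), crux `OrdLambdaHalfAtTwo` (item stmt-BirchSwinnertonDyer-19556), line `kato_determinant_greenberg_two`
# (skeleton v4.7): conjunct (4) `loc_injective` of the (PT) binder `ShapiroLatticePoitouTateAtTwoTheta` REDUCED to ONE printed input —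
# injectivity of `loc_w̄` on `𝐇¹_{K,Γ}(T₂W_K)` — in the habitat (`K` imaginary quadratic), from Kato Thm 12.4 (2) by name

Cell `bsd-2adic`, seat `bsd-2adic-conv-1` GEN 31 (`--supports stmt-BirchSwinnertonDyer-19556 --as helper`).  Companion of
`…ShapiroLatticeSupply` (GEN 30: the lattice clauses of (PT) for `L = range locOver`, with the local untwisting `u_A := localTwistHom` of the twist
equivalence `u`) and of the Literature file `Kato2004/IwasawaCohomologyNumberFieldTwistCross` (GEN 31: `res ⊕ res^A` injective on torsion-free
carriers; `loc_W ⊕ 𝐇¹(u_v) loc_A = loc_w̄ ∘ (res ⊕ res^A)`).  Here the two side conditions are discharged in the habitat: `[Γ_ℚ : galRange K] = 2`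
(`RelModel.index_galRange`, `K/ℚ` quadratic hence Galois) and the torsion-freeness of `𝐇¹_Γ(T₂W)`, `𝐇¹_Γ(T₂A)` BY NAME from the tree's named fact
`Kato2004.thm12_4` (Kato Thm 12.4 (2)).  RESULT `coprod_loc_injective_of_thm12_4_of_locOver_injective`: in the (PT) binder's vocabulary, for the
GEN-30 untwisting, `Function.Injective (loc_W ⊕ 𝐇¹(u_v)∘loc_A)` ⟸ `thm12_4` ∧ `Function.Injective loc_w̄` — so conjunct (4) of (PT) is, beyond
print, exactly «`loc_w̄` is injective on `H¹_Iw(K_Σ/K, T₂W)` when the BDP Selmer group over `K_∞` is `Λ`-cotorsion» (Greenberg 2010 Prop. 3.1.1).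

HONEST FRAMING.  THEOREMS ONLY; no definition, no named fact minted, no `sorry`; CONDITIONAL on `Kato2004.thm12_4` and on the displayed hypothesis
`hloc`; the crux is NOT proved here; BSD is not proved by any of this.  PARTITION (D-0054): none — RANK axis S3 × X5@2 stratum (β); closes none.
-/

set_option linter.dupNamespace false
set_option autoImplicit false

noncomputable section

open scoped NumberField
open Field IsDedekindDomain WeierstrassCurve CategoryTheory NumberField
open Literature.NumberTheory.GaloisRepresentations
open Literature.NumberTheory.EllipticCurves Literature.NumberTheory.EllipticCurves.Kato2004
open Literature.NumberTheory.EllipticCurves.Kato2004.EulerSystemValues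

namespace Summit.BirchSwinnertonDyer.BirchSwinnertonDyer.Theorems.TwoAdicShapiroLattice

/-- `[Γ_ℚ : galRange K] = 2` for an imaginary quadratic `K` (quadratic ⟹ Galois; `RelModel.index_galRange`). [folklore] -/
theorem index_galRange_eq_two {K : Type} [Field K] [NumberField K] (hK : IsImaginaryQuadratic K) : (galRange (K := ℚ) K).index = 2 := by
  haveI : Algebra.IsQuadraticExtension ℚ K := ((isImaginaryQuadratic_iff_isQuadraticExtension).mp hK).1
  haveI : IsGalois ℚ K := (IsAbelianGalois.of_isCyclic ℚ K).toIsGalois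
  rw [RelModel.index_galRange (K := ℚ) K, hK.1]

/-- **Conjunct (4) `loc_injective` of the (PT) binder from Kato Thm 12.4 (2) and ONE displayed input.**  In the habitat — `K` imaginary quadratic,
`κ` a `ℤ₂`… (any `p`) …-extension of `ℚ` with `κ ∘ res_{K/ℚ}` onto (`h`), `v` split (`hD`), the twist equivalence `u : T_pA ≃ T_pW` (`galRange`-equivariant,
anti-equivariant off it), pins `I_W, I_A, IK, J, J_A` — IF `loc_w̄ = IK.locOver J` is injective THEN `loc_W ⊕ 𝐇¹(u_v)∘loc_A` is injective, where
`u_v = localTwistHom v hD W A u hu hu₁` is GEN 30's local untwisting.  Torsion-freeness of `𝐇¹_Γ(T_pW)`, `𝐇¹_Γ(T_pA)` is Kato Thm 12.4 (2) BY NAME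
(`Kato2004.thm12_4`, `κ` cyclotomic). [cite: Kato2004Asterisque, Thm 12.4 (2) (p. 221), §17.13 (17.13.2) (p. 279)] [cite: Greenberg2010, Prop. 3.1.1]
[cite: GreenbergLNM1716, §4 p. 107] -/
theorem coprod_loc_injective_of_thm12_4_of_locOver_injective (h124 : Kato2004.thm12_4)
    {K : Type} [Field K] [NumberField K] (hK : IsImaginaryQuadratic K)
    {p : ℕ} [Fact p.Prime] {κ : ZpExtension ℚ p} (hκ : κ.IsCyclotomic)
    {h : Function.Surjective (κ.toContinuousMonoidHom.comp (absGaloisRestrict ℚ K))}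
    {v : HeightOneSpectrum (𝓞 ℚ)}
    {hD : ∀ g : absoluteGaloisGroup (v.adicCompletion ℚ), resGalOfEmb (closureEmb (K := ℚ) (v.adicCompletion ℚ)) g ∈ galRange (K := ℚ) K}
    {W A : WeierstrassCurve ℚ} [W.IsElliptic] [A.IsElliptic] [ContinuousSMul ℤ_[p] (W.tateModule p)]
    [ContinuousSMul ℤ_[p] (A.tateModule p)] [ContinuousSMul ℤ_[p] ((W.baseChange K).tateModule p)]
    (u : A.tateModule p ≃ₗ[ℤ_[p]] W.tateModule p) (hu : Continuous u) (hu' : Continuous u.symm)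
    (hu₁ : ∀ σ : absoluteGaloisGroup ℚ, σ ∈ galRange (K := ℚ) K → ∀ x : A.tateModule p, u (σ • x) = σ • u x)
    (hu₂ : ∀ σ : absoluteGaloisGroup ℚ, σ ∉ galRange (K := ℚ) K → ∀ x : A.tateModule p, u (σ • x) = -(σ • u x))
    {γ : absoluteGaloisGroup ℚ} {γK : absoluteGaloisGroup K} {γᵥ : absoluteGaloisGroup (v.adicCompletion ℚ)}
    (hγ : κ.IsTopGenerator γ) (hγK : (κ.restrict K h).IsTopGenerator γK)
    (hsurjv : Function.Surjective (κ.toContinuousMonoidHom.comp (resGalOfEmb (closureEmb (K := ℚ) (v.adicCompletion ℚ)))))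
    (hγᵥ : κ.IsTopGenerator (resGalOfEmb (closureEmb (K := ℚ) (v.adicCompletion ℚ)) γᵥ))
    (I_W : IwasawaH1Data W p κ γ) (I_A : IwasawaH1Data A p κ γ) (IK : IwasawaH1DataOver (W.baseChange K) p (κ.restrict K h) γK)
    (J : LocalIwasawaH1Data κ v ((tateRep W p).toLocal v) γᵥ) (J_A : LocalIwasawaH1Data κ v ((tateRep A p).toLocal v) γᵥ)
    (hloc : Function.Injective (IK.locOver J hD hsurjv hγK hγᵥ)) :
    Function.Injective
      ((I_W.loc J hsurjv hγ hγᵥ).coprod (J_A.map (localTwistHom v hD W A u hu hu₁) J ∘ₗ I_A.loc J_A hsurjv hγ hγᵥ)) := by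
  haveI : (galRange (K := ℚ) K).Normal := normal_galRange_of_finrank_eq_two K hK.1
  haveI : Module.IsTorsionFree (IwasawaAlgebra p) I_W.H := (h124 W p κ γ hκ hγ I_W).2.1.1
  haveI : Module.IsTorsionFree (IwasawaAlgebra p) I_A.H := (h124 A p κ γ hκ hγ I_A).2.1.1
  exact IK.coprod_loc_injective_of_locOver_injective u hu hu' hu₁ hu₂ I_W I_A J J_A (index_galRange_eq_two hK) hsurjv hγ hγK hγᵥ hloc

end Summit.BirchSwinnertonDyer.BirchSwinnertonDyer.Theorems.TwoAdicShapiroLattice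

end
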